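import Literature.AnabelianGeometry.SemiGraphs.TemperedAnabelianThm68SubProofs
import Literature.AnabelianGeometry.SemiGraphs.TemperedDLocTypePreservedProofs

/-!
# [SemiAnbd] Thm. 6.8 (iii) ASSEMBLED modulo named inputs: `α` preserves the decomposition groups of the torsion closed points ([Mzk8] Cor. 2.6)

Mochizuki, *Semi-graphs of anabelioids* [SemiAnbd], §6 Thm. 6.8 (iii), kurims p. 75; printed proof =
[Mzk8] (*Galois sections in absolute anabelian geometry*) Cor. 2.6 and its proof, ms. p. 10: the
`[n]`-object `Z_K → X_K` of `DLoc_K(X_K)` "exhibits the closed points of `X_K` that arise from the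
`n`-torsion points of the underlying elliptic curve as closed points of `DLoc`-type"; "by transporting
these constructions via the equivalences of Theorem 2.3, (i), and applying Theorem 1.3, (ii), (iii)"
one concludes. [cite: MochizukiSemiAnbd2006, Thm 6.8(iii) p.75] [cite: MochizukiGalSect2005, Cor 2.6 p.10]

Assembly (abc-iut cell, layer L3, seat abc-iut-w5-d040; sub-DAG row T68iii-A of
`plan/L3/SUBDAG-SemiAnbd-Thm68.md`) of the FROZEN node `TemperedCurve.IsoPreservesTorsionDecomp`
(`TemperedAnabelianMorphisms.lean`) from EXACTLY the named inputs, for genuine-morphism scheme data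
`DXs`, `DYs` (`DLocSchemeData`): the `[n]`-object description of torsion points (T68iii-L04
`TorsionIffMulNCuspImage`, both curves), the covering half of Thm. 6.8 (i) on objects (T68i-L01
`CoveringObjectOfOpenSubgroup`) and fullness of the tempered-π₁ functor (T68i-L04a `PiFunctorFull`),
both curves, Thm. 6.5 (iii) (`IsoPreservesCuspidalDecomp`, for `X_K ↔ Y_L` and for the curves
underlying the objects), Thm. 6.5 (ii) (`DecompCommensurablyTerminal`), compactness of decomposition
groups (T68-B1) and the tacit scheme-side fact T68-B4 (`CuspImageOpenInDecomp`), both curves, the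
hypothesis (hΔ) `α(Δ^temp_X) = Δ^temp_Y`, and the flag coherence "a cusp (the origin) is a torsion
point" (reading flag R-iii-2 of the sub-DAG).  The transport step is `Thm68Sub.exists_transported_witness`
(T68-B5 core) and `Thm68Sub.mulNSubgroupTransport_holds` (T68iii-L06).  Nothing of [SemiAnbd]/[Mzk8]
is asserted; the Tate-module clause of (iii) is not typed (see the node's TODO); nothing here takes a
side on [IUTchIII] Cor. 3.12.
-/

noncomputable section

namespace Literature.AnabelianGeometry.SemiGraphs

open scoped Pointwise
open CategoryTheory Topology

variable {p : ℕ} [Fact p.Prime]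

namespace Thm68Sub

variable {X Y : TemperedCurve p}

/-- `α⁻¹ ∘ α = id` on subgroups. [cite: MochizukiSemiAnbd2006, Thm 6.8 p.74] -/
theorem map_map_symm (α : X.PiTemp ≃ₜ* Y.PiTemp) (D : Subgroup X.PiTemp) :
    (D.map α.toMulEquiv.toMonoidHom).map α.symm.toMulEquiv.toMonoidHom = D := by
  ext z
  simp only [Subgroup.mem_map]
  constructor
  · rintro ⟨_, ⟨d, hd, rfl⟩, rfl⟩
    change α.symm (α d) ∈ D
    rwa [α.symm_apply_apply]
  · intro hz
    exact ⟨α z, ⟨z, hz, rfl⟩, α.symm_apply_apply z⟩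

/-- (hΔ) for `α⁻¹`. [cite: MochizukiSemiAnbd2006, Thm 6.8 p.74] -/
theorem deltaTemp_map_symm (α : X.PiTemp ≃ₜ* Y.PiTemp)
    (hΔ : X.DeltaTemp.map α.toMulEquiv.toMonoidHom = Y.DeltaTemp) :
    Y.DeltaTemp.map α.symm.toMulEquiv.toMonoidHom = X.DeltaTemp := by
  rw [← hΔ, map_map_symm]

/-- **One direction of [Mzk8] Cor. 2.6, transported** — for a torsion closed point `x` of the
once-punctured elliptic curve `X_K`: the `[n]`-object witness of `x` (T68iii-L04 ⇒) is carried along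
`α` (T68iii-L06: `α(H)` is again an `[n]`-subgroup; T68i-L01: it is `Π^temp` of a covering of `Y_L`
with no cusp filled in, which realises the transported object ON THE NOSE; T68-B5 core
`exists_transported_witness`) to an `[n]`-object witness of a closed point `y` of `Ȳ_L`, which is
therefore torsion (T68iii-L04 ⇐; a cusp is the origin, a torsion point), with `α(D_x)` a conjugate of
`D_y`. [cite: MochizukiGalSect2005, Cor 2.6 p.10] -/
theorem exists_torsion_of_torsion (DXs : DLocSchemeData X) (DYs : DLocSchemeData Y)
    (aX : TemperedCurve.CurveArithmeticFlags X) (aY : TemperedCurve.CurveArithmeticFlags Y)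
    (α : X.PiTemp ≃ₜ* Y.PiTemp)
    (hΔ : X.DeltaTemp.map α.toMulEquiv.toMonoidHom = Y.DeltaTemp)
    (h65 : X.IsoPreservesCuspidalDecomp Y)
    (h65iii : ∀ (Z : DXs.DLocK) (Z' : DYs.DLocK),
      (DXs.curve Z).IsoPreservesCuspidalDecomp (DYs.curve Z'))
    (hFullY : PiFunctorFull Y DYs) (hCovY : CoveringObjectOfOpenSubgroup Y DYs)
    (hB4Y : CuspImageOpenInDecomp Y DYs) (hcX : DecompCompact X) (hcY : DecompCompact Y)
    (hctX : X.DecompCommensurablyTerminal) (hctY : Y.DecompCommensurablyTerminal)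
    (hL04X : TorsionIffMulNCuspImage X DXs aX) (hL04Y : TorsionIffMulNCuspImage Y DYs aY)
    (hcuspY : ∀ y : Y.Pt, Y.IsCusp y → aY.IsTorsionPt y)
    (hEX : aX.IsOncePuncturedElliptic) (hEY : aY.IsOncePuncturedElliptic)
    {x : X.Pt} (hx : aX.IsTorsionPt x) :
    ∃ y : Y.Pt, aY.IsTorsionPt y ∧
      ∃ γ' : ConjAct Y.PiTemp, (X.decomp x).map α.toMulEquiv.toMonoidHom = γ' • Y.decomp y := by
  letI := DXs.catK; letI := DYs.catK
  letI := DLocObj.dlocCategory X; letI := DLocObj.dlocCategory Y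
  have hI : ∀ I : Subgroup X.PiTemp, X.IsCuspidalGeometricDecompositionGroup I →
      Y.IsCuspidalGeometricDecompositionGroup (I.map α.toMulEquiv.toMonoidHom) :=
    fun I h => (h65 α I).2 h
  -- the `[n]`-object witness of `x`
  obtain ⟨n, hn, Zn, ψ, hHn, hg, Dz, γ₀, hDz, hrest⟩ := (hL04X hEX x).1 (Or.inl hx)
  -- its transport: `α(H)` is an `[n]`-subgroup of `Π^temp_{Y_L}`, realised by a covering of `Y_L`
  have hHn' : IsMulNSubgroup Y n ((DXs.pi1Functor.obj Zn).H.map α.toMulEquiv.toMonoidHom) :=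
    mulNSubgroupTransport_holds α hΔ h65 n _ hHn
  obtain ⟨Zn', hH', hg'⟩ := hCovY _ hHn'.1 hHn'.2.1
  have hH : (DYs.pi1Functor.obj Zn').H = ((DXs.pi1Functor.obj Zn).transport α hI hΔ).H := hH'
  have hN : (DYs.pi1Functor.obj Zn').N = ((DXs.pi1Functor.obj Zn).transport α hI hΔ).N := by
    change _ = (DXs.pi1Functor.obj Zn).N.map α.toMulEquiv.toMonoidHom
    exact (map_N_eq_of_gens_empty α _ hg _ hg').symm
  -- the transported witness (T68-B5 core) for the on-the-nose realisation
  obtain ⟨f', Dz', γy, y, hDz', hrestY, γ', hconj⟩ :=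
    exists_transported_witness DXs DYs α hI hΔ hFullY h65iii hB4Y hcX hcY hctX hctY ψ Dz γ₀ hDz
      hrest.1 hrest.2 (DLocObj.isoOfEquiv (jEquivOfEq _ _ hH hN) (augJ_jEquivOfEq _ _ hH hN))
  -- `y` is torsion: the transported witness is an `[n]`-object witness for `y`
  have hHy : IsMulNSubgroup Y n (DYs.pi1Functor.obj Zn').H := by rw [hH']; exact hHn'
  have hy : aY.IsTorsionPt y ∨ Y.IsCusp y :=
    (hL04Y hEY y).2 ⟨n, hn, Zn', f', hHy, hg', Dz', γy, hDz', hrestY⟩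
  rcases hy with hy | hy
  · exact ⟨y, hy, γ', hconj⟩
  · exact ⟨y, hcuspY y hy, γ', hconj⟩

/-- **T68iii-A ASSEMBLED modulo named inputs** — [SemiAnbd] Thm. 6.8 (iii) (`α` carries the conjugates
of the `D_x`, `x` torsion, exactly onto the conjugates of the `D_y`, `y` torsion), from the
`[n]`-object description of torsion points, Thm. 6.8 (i) (coverings + fullness), Thm. 6.5 (ii)(iii),
compactness, T68-B4, (hΔ) and "the origin is a torsion point", for both curves — the direction
`Y_L → X_K` being the direction `X_K → Y_L` for `α⁻¹`. [cite: MochizukiSemiAnbd2006, Thm 6.8(iii) p.75]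
[cite: MochizukiGalSect2005, Cor 2.6 p.10] -/
theorem isoPreservesTorsionDecomp_of (DXs : DLocSchemeData X) (DYs : DLocSchemeData Y)
    (aX : TemperedCurve.CurveArithmeticFlags X) (aY : TemperedCurve.CurveArithmeticFlags Y)
    (α : X.PiTemp ≃ₜ* Y.PiTemp)
    (hΔ : X.DeltaTemp.map α.toMulEquiv.toMonoidHom = Y.DeltaTemp)
    (h65 : X.IsoPreservesCuspidalDecomp Y) (h65' : Y.IsoPreservesCuspidalDecomp X)
    (h65iii : ∀ (Z : DXs.DLocK) (Z' : DYs.DLocK),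
      (DXs.curve Z).IsoPreservesCuspidalDecomp (DYs.curve Z'))
    (h65iii' : ∀ (Z' : DYs.DLocK) (Z : DXs.DLocK),
      (DYs.curve Z').IsoPreservesCuspidalDecomp (DXs.curve Z))
    (hFullX : PiFunctorFull X DXs) (hFullY : PiFunctorFull Y DYs)
    (hCovX : CoveringObjectOfOpenSubgroup X DXs) (hCovY : CoveringObjectOfOpenSubgroup Y DYs)
    (hB4X : CuspImageOpenInDecomp X DXs) (hB4Y : CuspImageOpenInDecomp Y DYs)
    (hcX : DecompCompact X) (hcY : DecompCompact Y)
    (hctX : X.DecompCommensurablyTerminal) (hctY : Y.DecompCommensurablyTerminal)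
    (hL04X : TorsionIffMulNCuspImage X DXs aX) (hL04Y : TorsionIffMulNCuspImage Y DYs aY)
    (hcuspX : ∀ x : X.Pt, X.IsCusp x → aX.IsTorsionPt x)
    (hcuspY : ∀ y : Y.Pt, Y.IsCusp y → aY.IsTorsionPt y) :
    TemperedCurve.IsoPreservesTorsionDecomp X Y aX aY α := by
  intro hEX hEY D
  constructor
  · rintro ⟨x, hx, γ, rfl⟩
    obtain ⟨y, hy, γ', hconj⟩ := exists_torsion_of_torsion DXs DYs aX aY α hΔ h65 h65iii hFullY
      hCovY hB4Y hcX hcY hctX hctY hL04X hL04Y hcuspY hEX hEY hx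
    refine ⟨y, hy, ConjAct.toConjAct (α (ConjAct.ofConjAct γ)) * γ', ?_⟩
    have h1 : (γ • X.decomp x).map α.toMulEquiv.toMonoidHom =
        ConjAct.toConjAct (α (ConjAct.ofConjAct γ)) • (X.decomp x).map α.toMulEquiv.toMonoidHom := by
      have := map_smul_eq α.toMulEquiv.toMonoidHom (ConjAct.ofConjAct γ) (X.decomp x)
      rw [ConjAct.toConjAct_ofConjAct] at this
      exact this
    rw [h1, hconj, mul_smul]
  · rintro ⟨y, hy, γ, hD⟩
    obtain ⟨x, hx, γ'', hconj⟩ := exists_torsion_of_torsion DYs DXs aY aX α.symm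
      (deltaTemp_map_symm α hΔ) h65' h65iii' hFullX hCovX hB4X hcY hcX hctY hctX hL04Y hL04X
      hcuspX hEY hEX hy
    refine ⟨x, hx, ConjAct.toConjAct (α.symm (ConjAct.ofConjAct γ)) * γ'', ?_⟩
    have h1 : (γ • Y.decomp y).map α.symm.toMulEquiv.toMonoidHom =
        ConjAct.toConjAct (α.symm (ConjAct.ofConjAct γ)) •
          (Y.decomp y).map α.symm.toMulEquiv.toMonoidHom := by
      have := map_smul_eq α.symm.toMulEquiv.toMonoidHom (ConjAct.ofConjAct γ) (Y.decomp y)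
      rw [ConjAct.toConjAct_ofConjAct] at this
      exact this
    rw [← map_map_symm α D, hD, h1, hconj, mul_smul]

end Thm68Sub

end Literature.AnabelianGeometry.SemiGraphs

end
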